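import Summits.CriticalPhenomena.PercolationContinuityZ3.Theorems.PercNearOneGluingNoHeavyLowerTailCertCells
import Summits.CriticalPhenomena.PercolationContinuityZ3.Theorems.PercNearOneGluingNearOneGluingWeightContinuity
import Literature.Probability.LatticeModels.ProdBernoulliAtomExpansion
import HarnessLib

/-!
# `NoHeavyLowerTail` (stmt-CriticalPhenomena-4575) — certificate machine, part 3:
# certificates, positivity of the pattern cells and the weight-continuity wrapper

Support file (depth prover nh-dp-blobmono gen 3; `--supports stmt-CriticalPhenomena-4575`).  No named facts,
no sorries, standard axioms.

This file assembles certificates and proves the certificate theorem: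

* `Cert` — a full certificate (target `L`, references `U`, row specs of part 2, multiplier terms) with
  `Cert.checkB` (the bucketed kernel check of part 1) and the measure-level soundness `Cert.sound` /
  `Cert.exists_le`: if all buckets pass, `Σ_a w_a m_a(x) (μ L − μ U_{ref a}) ≤ 0` at `x_c = μ(Cell v c)`, hence
  `μ L ≤ μ U_{ref a}` for some `a` PROVIDED one multiplier monomial has positive mass; the rest of the file removes
  this proviso for DISTINCT terminals:

* `testBit_trans_of_mem_consPatterns` — the 52 consistent patterns are transitive (`decide`), so the relation
  `rel m` ("same block") is an equivalence on the five terminal indices;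
* `cfg v m` — the canonical configuration of pattern `m` (open exactly the terminal pairs inside the blocks);
  `cyl v m` — the cylinder of configurations agreeing with it off the diagonal; `cyl_subset_cell` — for an
  injective placement `v` the cylinder lies in `Cell v m` (walks stay inside blocks); `cell_pos` — hence every
  consistent cell has positive mass as soon as all off-diagonal weights lie in `(0, 1)`
  (`prodBernoulli_real_setOf_forall_iff`);
* `mixW w k` — the weights mixed towards `1/2` (`(1 − c_k) w + c_k / 2`, `c_k → 0`), all in `(0, 1)`, converging
  to `w`; with `stub_weightContinuity` (continuity of `w ↦ μ_w(E)`) the conclusion passes to the limit: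
* `Cert.exists_le_of_injective` — THE WRAPPER: valid rows + all buckets pass + one multiplier term with positive
  weight on consistent cells (`Cert.posTerm`, decidable) ⇒ for EVERY weighted graph and every injective
  placement of the five terminals, `μ(L) ≤ μ(U_{ref a})` for some multiplier term `a`.
-/

noncomputable section

namespace Summit.CriticalPhenomena.PercolationContinuityZ3.Theorems

open MeasureTheory Set Filter Literature.Probability.Percolation
open Literature.Probability.LatticeModels (prodBernoulli prodBernoulli_real_setOf_forall_iff)
open scoped Classical BigOperators Topology
open PatternCells CertCheck

namespace CertCells

variable {n : ℕ}

/-! ## Certificates and their measure-level soundness -/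

/-- A certificate: target formula `L`, reference formulas `U` (indexed by position), row specs, multiplier
terms (`ATerm.ref` indexes `U`). [folklore] -/
structure Cert where
  /-- the target event -/
  L : Formula
  /-- the reference events -/
  U : List Formula
  /-- the rows (instances of tree lemmas) -/
  rows : List RowSpec
  /-- the multiplier terms `w_a · m_a · (L − U_{ref a})` -/
  al : List ATerm

/-- All row specs satisfy their side conditions. [folklore] -/
def Cert.rowsValid (C : Cert) : Bool := C.rows.all RowSpec.valid

/-- Cells of the reference event number `ref` (empty beyond the list). [folklore] -/
def Cert.Ucells (C : Cert) (ref : ℕ) : List ℕ := cellsOf (C.U.getD ref [])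

/-- The bucketed kernel check of a certificate (bucket `b` of `nb`). [folklore] -/
def Cert.checkB (C : Cert) (nb b : ℕ) : Bool :=
  CertCheck.checkB nb b (cellsOf C.L) C.Ucells (C.rows.map RowSpec.toRow) C.al

/-- **Measure-level soundness.**  If the row specs are valid and every bucket passes, then for every weighted
graph and every placement `v` of the five terminals, with `x_c = μ(Cell v c)`:
`Σ_a w_a m_a(x) (μ(L) − μ(U_{ref a})) ≤ 0`. [folklore] -/
theorem Cert.sound (C : Cert) (hvalid : C.rowsValid = true) {nb : ℕ} (hnb : 0 < nb)
    (hcheck : ∀ b < nb, C.checkB nb b = true) (w : Sym2 (Fin n) → unitInterval) (v : Fin 5 → Fin n) :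
    (C.al.map fun a => (a.wt : ℝ) * evalM (fun m => (prodBernoulli w).real (Cell v m)) a.mult *
      ((prodBernoulli w).real (C.L.set v) - (prodBernoulli w).real ((C.U.getD a.ref []).set v))).sum ≤ 0 := by
  have hx : ∀ i, 0 ≤ (fun m => (prodBernoulli w).real (Cell v m)) i := fun _ => measureReal_nonneg
  have hrows : ∀ r ∈ C.rows.map RowSpec.toRow,
      linEval (fun m => (prodBernoulli w).real (Cell v m)) r.e1 *
          linEval (fun m => (prodBernoulli w).real (Cell v m)) r.e2 ≤
        linEval (fun m => (prodBernoulli w).real (Cell v m)) r.e3 *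
          linEval (fun m => (prodBernoulli w).real (Cell v m)) r.e4 := by
    intro r hr
    obtain ⟨s, hs, rfl⟩ := List.mem_map.1 hr
    unfold Cert.rowsValid at hvalid
    exact RowSpec.holds s ((List.all_eq_true.1 hvalid) s hs) w v
  have key := sound_of_buckets (fun m => (prodBernoulli w).real (Cell v m)) hx (cellsOf C.L) C.Ucells
    (C.rows.map RowSpec.toRow) C.al hnb hrows hcheck
  simp only [Cert.Ucells, ← measureReal_set_eq_linEval] at key
  exact key

/-- **One reference suffices** once a multiplier term has positive mass: `μ(L) ≤ μ(U_{ref a})` for some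
`a ∈ al`. [folklore] -/
theorem Cert.exists_le (C : Cert) (hvalid : C.rowsValid = true) {nb : ℕ} (hnb : 0 < nb)
    (hcheck : ∀ b < nb, C.checkB nb b = true) (w : Sym2 (Fin n) → unitInterval) (v : Fin 5 → Fin n)
    (hpos : ∃ a ∈ C.al, 0 < (a.wt : ℝ) * evalM (fun m => (prodBernoulli w).real (Cell v m)) a.mult) :
    ∃ a ∈ C.al, (prodBernoulli w).real (C.L.set v) ≤ (prodBernoulli w).real ((C.U.getD a.ref []).set v) := by
  have hx : ∀ i, 0 ≤ (fun m => (prodBernoulli w).real (Cell v m)) i := fun _ => measureReal_nonneg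
  have hs := C.sound hvalid hnb hcheck w v
  simp only [measureReal_set_eq_linEval] at hs ⊢
  have := exists_le_of_sound (fun m => (prodBernoulli w).real (Cell v m)) hx (cellsOf C.L) C.Ucells C.al
    (by simpa [Cert.Ucells] using hs) hpos
  simpa [Cert.Ucells] using this

/-! ## Consistent patterns are equivalence relations on the terminal indices -/

/-- Consistent patterns have no diagonal bit (they are `< 1024`; the diagonal pair number is `10`). [folklore] -/
theorem testBit_diag_of_mem_consPatterns :
    ∀ m ∈ consPatterns, ∀ i : Fin 5, Nat.testBit m (pairIdx i i) = false := by
  decide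

/-- Consistent patterns are transitive on distinct terminals. [folklore] -/
theorem testBit_trans_of_mem_consPatterns :
    ∀ m ∈ consPatterns, ∀ i j k : Fin 5, i ≠ j → j ≠ k → i ≠ k →
      Nat.testBit m (pairIdx i j) = true → Nat.testBit m (pairIdx j k) = true →
        Nat.testBit m (pairIdx i k) = true := by
  decide

/-- Every pair number comes from an increasing pair of terminals carrying that number. [folklore] -/
theorem pairFst_lt_pairSnd : ∀ p : Fin 10, pairFst p < pairSnd p ∧ pairIdx (pairFst p) (pairSnd p) = p.val := by
  decide

/-- "Same block" relation of a pattern on the terminal indices. [folklore] -/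
def rel (m : ℕ) (i j : Fin 5) : Prop := i = j ∨ Nat.testBit m (pairIdx i j) = true

/-- `rel` is reflexive. [folklore] -/
theorem rel_refl (m : ℕ) (i : Fin 5) : rel m i i := Or.inl rfl

/-- `rel` is symmetric. [folklore] -/
theorem rel_symm {m : ℕ} {i j : Fin 5} (h : rel m i j) : rel m j i := by
  rcases h with rfl | h
  · exact Or.inl rfl
  · right; rwa [pairIdx_comm]

/-- `rel` is transitive on consistent patterns. [folklore] -/
theorem rel_trans {m : ℕ} (hm : m ∈ consPatterns) {i j k : Fin 5} (hij : rel m i j) (hjk : rel m j k) :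
    rel m i k := by
  rcases hij with rfl | hij
  · exact hjk
  rcases hjk with rfl | hjk
  · exact Or.inr hij
  by_cases hik : i = k
  · exact Or.inl hik
  have hij' : i ≠ j := by
    rintro rfl
    rw [testBit_diag_of_mem_consPatterns m hm i] at hij
    exact Bool.false_ne_true hij
  have hjk' : j ≠ k := by
    rintro rfl
    rw [testBit_diag_of_mem_consPatterns m hm j] at hjk
    exact Bool.false_ne_true hjk
  exact Or.inr (testBit_trans_of_mem_consPatterns m hm i j k hij' hjk' hik hij hjk)

/-! ## The canonical configuration of a pattern and its cylinder -/

/-- The canonical configuration of pattern `m`: open exactly the terminal pairs inside the blocks. [folklore] -/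
def cfg (v : Fin 5 → Fin n) (m : ℕ) : BondConfig (Fin n) :=
  {e | ∃ i j : Fin 5, i ≠ j ∧ Nat.testBit m (pairIdx i j) = true ∧ e = s(v i, v j)}

/-- The off-diagonal pairs. [folklore] -/
def offDiag (n : ℕ) : Finset (Sym2 (Fin n)) := Finset.univ.filter fun e => ¬ e.IsDiag

/-- The cylinder of configurations agreeing with `cfg v m` off the diagonal. [folklore] -/
def cyl (v : Fin 5 → Fin n) (m : ℕ) : Set (BondConfig (Fin n)) :=
  {ω | ∀ e ∈ offDiag n, e ∈ ω ↔ e ∈ cfg v m}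

/-- A pair of distinct vertices is off-diagonal. [folklore] -/
theorem mk_mem_offDiag {x y : Fin n} (h : x ≠ y) : s(x, y) ∈ offDiag n := by
  simp [offDiag, Sym2.mk_isDiag_iff, h]

/-- In a configuration of the cylinder, open walks from the block of `v i` stay in the block of `v i`
(injective placement, consistent pattern). [folklore] -/
theorem walk_mem_block {v : Fin 5 → Fin n} (hv : Function.Injective v) {m : ℕ} (hm : m ∈ consPatterns)
    {ω : BondConfig (Fin n)} (hω : ω ∈ cyl v m) (i : Fin 5) :
    ∀ {u x : Fin n} (_ : (openGraph ω).Walk u x), (∃ k, u = v k ∧ rel m i k) → ∃ k, x = v k ∧ rel m i k := by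
  intro u x p
  induction p with
  | nil => exact id
  | cons hadj _ ih =>
    intro hu
    apply ih
    obtain ⟨k, rfl, hik⟩ := hu
    rw [openGraph_adj] at hadj
    obtain ⟨hmem, hne⟩ := hadj
    obtain ⟨i', j', _, hbit, heq⟩ := (hω _ (mk_mem_offDiag hne)).1 hmem
    rcases Sym2.eq_iff.1 heq with ⟨h1, h2⟩ | ⟨h1, h2⟩
    · have hk : k = i' := hv h1
      subst hk
      exact ⟨j', h2, rel_trans hm hik (Or.inr hbit)⟩
    · have hk : k = j' := hv h1
      subst hk
      exact ⟨i', h2, rel_trans hm hik (rel_symm (Or.inr hbit))⟩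

/-- **The cylinder lies in the cell** (injective placement, consistent pattern). [folklore] -/
theorem cyl_subset_cell {v : Fin 5 → Fin n} (hv : Function.Injective v) {m : ℕ} (hm : m ∈ consPatterns) :
    cyl v m ⊆ Cell v m := by
  intro ω hω p
  obtain ⟨hlt, hidx⟩ := pairFst_lt_pairSnd p
  have hij : pairFst p ≠ pairSnd p := ne_of_lt hlt
  show (openGraph ω).Reachable (v (pairFst p)) (v (pairSnd p)) ↔ Nat.testBit m p.val = true
  rw [← hidx]
  constructor
  · rintro ⟨q⟩
    obtain ⟨k, hk, hrel⟩ := walk_mem_block hv hm hω (pairFst p) q ⟨pairFst p, rfl, rel_refl m _⟩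
    have hk' : pairSnd p = k := hv hk
    subst hk'
    rcases hrel with h | h
    · exact absurd h hij
    · exact h
  · intro hbit
    have hmem : s(v (pairFst p), v (pairSnd p)) ∈ ω :=
      (hω _ (mk_mem_offDiag (hv.ne hij))).2 ⟨pairFst p, pairSnd p, hij, hbit, rfl⟩
    exact SimpleGraph.Adj.reachable ((openGraph_adj ω _ _).2 ⟨hmem, hv.ne hij⟩)

/-- The mass of the cylinder is the product of its off-diagonal factors. [folklore] -/
theorem measureReal_cyl (w : Sym2 (Fin n) → unitInterval) (v : Fin 5 → Fin n) (m : ℕ) :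
    (prodBernoulli w).real (cyl v m) =
      ∏ e ∈ offDiag n, (if e ∈ cfg v m then ((w e : unitInterval) : ℝ) else 1 - ((w e : unitInterval) : ℝ)) :=
  prodBernoulli_real_setOf_forall_iff w (offDiag n) fun e => e ∈ cfg v m

/-- **Consistent cells have positive mass** when all off-diagonal weights lie in `(0, 1)` and the terminals are
distinct. [folklore] -/
theorem cell_pos (w : Sym2 (Fin n) → unitInterval)
    (hw : ∀ e : Sym2 (Fin n), ¬ e.IsDiag → 0 < ((w e : unitInterval) : ℝ) ∧ ((w e : unitInterval) : ℝ) < 1)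
    {v : Fin 5 → Fin n} (hv : Function.Injective v) {m : ℕ} (hm : m ∈ consPatterns) :
    0 < (prodBernoulli w).real (Cell v m) := by
  refine lt_of_lt_of_le ?_ (measureReal_mono (cyl_subset_cell hv hm))
  rw [measureReal_cyl]
  refine Finset.prod_pos fun e he => ?_
  have hd : ¬ e.IsDiag := (Finset.mem_filter.1 he).2
  obtain ⟨h0, h1⟩ := hw e hd
  split_ifs
  · exact h0
  · linarith

/-! ## Weights mixed towards `1/2` -/

/-- The mixing coefficient `c_k = 1 / (2 (k + 1))`. [folklore] -/
def mixC (k : ℕ) : ℝ := 1 / ((k : ℝ) + 1) / 2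

/-- `0 < c_k`. [folklore] -/
theorem mixC_pos (k : ℕ) : 0 < mixC k := by
  unfold mixC; positivity

/-- `c_k ≤ 1/2`. [folklore] -/
theorem mixC_le_half (k : ℕ) : mixC k ≤ 1 / 2 := by
  unfold mixC
  have hk : (1 : ℝ) ≤ (k : ℝ) + 1 := by linarith [(Nat.cast_nonneg k : (0 : ℝ) ≤ k)]
  have : 1 / ((k : ℝ) + 1) ≤ 1 := by
    rw [div_le_one (by linarith)]; exact hk
  linarith

/-- `c_k → 0`. [folklore] -/
theorem tendsto_mixC : Tendsto mixC atTop (𝓝 0) := by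
  have h := (tendsto_one_div_add_atTop_nhds_zero_nat (𝕜 := ℝ)).div_const 2
  rw [zero_div] at h
  exact h

/-- The mixed weights `(1 − c_k) w + c_k / 2`. [folklore] -/
def mixW (w : Sym2 (Fin n) → unitInterval) (k : ℕ) : Sym2 (Fin n) → unitInterval := fun e =>
  ⟨(1 - mixC k) * ((w e : unitInterval) : ℝ) + mixC k / 2, by
    have h0 := mixC_pos k
    have h1 := mixC_le_half k
    have hw0 := (w e).2.1
    have hw1 := (w e).2.2
    constructor
    · nlinarith
    · nlinarith⟩

/-- The mixed weights lie in `(0, 1)`. [folklore] -/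
theorem mixW_pos_lt_one (w : Sym2 (Fin n) → unitInterval) (k : ℕ) (e : Sym2 (Fin n)) :
    0 < ((mixW w k e : unitInterval) : ℝ) ∧ ((mixW w k e : unitInterval) : ℝ) < 1 := by
  have h0 := mixC_pos k
  have h1 := mixC_le_half k
  have hw0 := (w e).2.1
  have hw1 := (w e).2.2
  show 0 < (1 - mixC k) * ((w e : unitInterval) : ℝ) + mixC k / 2 ∧
    (1 - mixC k) * ((w e : unitInterval) : ℝ) + mixC k / 2 < 1
  constructor
  · nlinarith
  · nlinarith

/-- The mixed weights converge to `w`. [folklore] -/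
theorem tendsto_mixW (w : Sym2 (Fin n) → unitInterval) : Tendsto (mixW w) atTop (𝓝 w) := by
  refine tendsto_pi_nhds.2 fun e => ?_
  rw [tendsto_subtype_rng]
  have h : Tendsto (fun k => (1 - mixC k) * ((w e : unitInterval) : ℝ) + mixC k / 2) atTop
      (𝓝 ((1 - 0) * ((w e : unitInterval) : ℝ) + 0 / 2)) :=
    ((tendsto_const_nhds.sub tendsto_mixC).mul tendsto_const_nhds).add (tendsto_mixC.div_const 2)
  simp only [sub_zero, one_mul, zero_div, add_zero] at h
  exact h

/-! ## The wrapper -/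

/-- A multiplier term with positive weight whose monomial consists of consistent cells (decidable). [folklore] -/
def Cert.posTerm (C : Cert) : Bool :=
  C.al.any fun a => decide (0 < a.wt) && a.mult.all fun c => decide (c ∈ consPatterns)

/-- **The certificate theorem.**  If the row specs of `C` are valid, every bucket of the kernel check passes, and
`C` has a positive term on consistent cells, then for EVERY weighted graph on `Fin n` and every INJECTIVE
placement `v` of the five terminals, `μ(L) ≤ μ(U_{ref a})` for some multiplier term `a` of `C`.
(Positivity of the cells at the mixed weights `mixW w k`, `Cert.exists_le` there, and the limit `k → ∞` by
continuity of `w ↦ μ_w(E)`.) [folklore] -/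
theorem Cert.exists_le_of_injective (C : Cert) (hvalid : C.rowsValid = true) {nb : ℕ} (hnb : 0 < nb)
    (hcheck : ∀ b < nb, C.checkB nb b = true) (hterm : C.posTerm = true)
    (w : Sym2 (Fin n) → unitInterval) {v : Fin 5 → Fin n} (hv : Function.Injective v) :
    ∃ a ∈ C.al, (prodBernoulli w).real (C.L.set v) ≤ (prodBernoulli w).real ((C.U.getD a.ref []).set v) := by
  -- the positive term
  obtain ⟨a₀, ha₀, hwa⟩ := List.any_eq_true.1 hterm
  rw [Bool.and_eq_true, decide_eq_true_eq, List.all_eq_true] at hwa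
  obtain ⟨hwt, hmult⟩ := hwa
  -- the conclusion at every mixed weight
  have hk : ∀ k, ∃ a ∈ C.al, (prodBernoulli (mixW w k)).real (C.L.set v) ≤
      (prodBernoulli (mixW w k)).real ((C.U.getD a.ref []).set v) := by
    intro k
    refine C.exists_le hvalid hnb hcheck (mixW w k) v ⟨a₀, ha₀, mul_pos (by exact_mod_cast hwt) ?_⟩
    unfold evalM
    refine List.prod_pos fun y hy => ?_
    obtain ⟨c, hc, rfl⟩ := List.mem_map.1 hy
    have hc' : c ∈ consPatterns := by simpa using hmult c hc
    exact cell_pos (mixW w k) (fun e _ => mixW_pos_lt_one w k e) hv hc'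
  -- the limit
  by_contra hcon
  push Not at hcon
  have hev : ∀ a ∈ C.al.toFinset, ∀ᶠ k in atTop,
      (prodBernoulli (mixW w k)).real ((C.U.getD a.ref []).set v) <
        (prodBernoulli (mixW w k)).real (C.L.set v) := by
    intro a ha
    exact (((stub_weightContinuity n _).tendsto w).comp (tendsto_mixW w)).eventually_lt
      (((stub_weightContinuity n _).tendsto w).comp (tendsto_mixW w)) (hcon a (List.mem_toFinset.1 ha))
  obtain ⟨k, hk'⟩ := ((Finset.eventually_all _).2 hev).exists
  obtain ⟨a, ha, hle⟩ := hk k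
  exact absurd hle (not_le.2 (hk' a (List.mem_toFinset.2 ha)))

end CertCells

end Summit.CriticalPhenomena.PercolationContinuityZ3.Theorems

end
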